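import Literature.AnabelianGeometry.SemiGraphs.TemperedPiVerticialLevelData
import Literature.AnabelianGeometry.SemiGraphs.TemperedHbddOfLocallyFinite
import HarnessLib

/-!
# The trees `𝔾̃_n` of a Galois tower over a LOCALLY FINITE `𝔾` are locally finite at vertices
# (discharge of the binder `hlocfin` at the canonical tower of [SemiAnbd] Prop. 3.6)

Mochizuki, *Semi-graphs of anabelioids*, Publ. RIMS **42** (2006), §3: Def. 3.5 (i) / p. 37 (the underlying
semi-graph `𝔾_S` of a covering object `S` and of the levels `𝒢_{∞,i}` of the tower defining `π₁^temp(𝒢)`,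
p. 38) and the proof of Theorem 3.7 (iii), manuscript p. 41 [cite: MochizukiSemiAnbd2006, Thm 3.7(iii) p.41]
("`H` … acts continuously on the semi-graph `𝒢_{∞,i}` … the action of `H` is over `𝒢`").

PROOF-ONLY file (cell abc-iut, layer L3, self-named row HLOCFIN-DISCHARGE = abc-iut-w6-d063's WAKE row
«binder discharge hlocfin», L3-lead α114 GO; seat abc-iut-w6-d120; label [typed-form audit / erratum picture
at locally finite `𝔾`; not a member of the [IUTchIII] Cor. 3.12 cone]).  Several level-data theorems of the
Thm 3.7 (iii)/(iv) programme at INFINITE graphs carry the binder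
`hlocfin : ∀ j x, {b : (D.tree j).Branch | (D.tree j).abuts b = some x}.Finite` (the level trees are locally
finite at vertices; e.g. abc-iut-w6-d063's `VerticialLevelData.isMaximalCompactSubgroup_of_mem_verticialSubgroups_of_isGraph`,
`TreeSystemFixedSystemUnique.lean`, `ArithVertGpStabilizerOfEdgeData.lean`).  This file DISCHARGES it at
the canonical tower `galoisLevelData h36` (hence at the level data of record
`verticialLevelData_temperedPiChart`) whenever the underlying semi-graph `𝔾` is locally finite:

* `SemiGraph.finite_star_of_isImmersion_of_finite` — local finiteness pulls back along immersions (local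
  form of `SemiGraph.finite_star_of_isImmersion`, which assumes a finite target);
* `CovObj.finite_oEdge_over`, `CovObj.finite_star_orbitGraph` — the underlying semi-graph `𝔾_S` of a FINITE
  covering object `S` is locally finite at every vertex-orbit over a vertex of `𝔾` with finitely many
  branches (a branch of `𝔾_S` at `V` is a pair `(b, E)`: `b` a branch of `𝔾` at the base of `V`, `E` an orbit
  of the finite fibre over the edge of `b`); `CovObj.orbitGraph_isLocallyFinite`;
* `GaloisLevelData.finite_star_tree` — the tree `𝔾̃_n` (immersed in `𝔾_{S n}` by `treeQuot`) is locally
  finite at vertices when the `n`-th level is finite and `𝔾` is locally finite;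
  `finite_star_tree_galoisLevelData`, `hlocfin_verticialLevelData_temperedPiChart` — the binder `hlocfin`
  at the canonical tower / the level data of record, for every locally finite `𝔾`.

No new definition; nothing here asserts anything about Thm 3.7 itself; nothing here takes a side on
[IUTchIII] Cor. 3.12.
-/

namespace Literature.AnabelianGeometry.SemiGraphs

open CategoryTheory Topology

universe u

/-! ### Local finiteness pulls back along immersions -/

namespace SemiGraph

/-- **Local finiteness pulls back along an immersion**: if `q : T → L` is an immersion (injective on the
branches at each vertex) and `L` has finitely many branches at `q x`, then `T` has finitely many branches at
`x`. [cite: MochizukiSemiAnbd2006, §1 pp.13-14] -/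
theorem finite_star_of_isImmersion_of_finite {T L : SemiGraph.{u}} (q : T ⟶ L) (hq : IsImmersion q)
    (x : T.Vertex) (h : {b : L.Branch | L.abuts b = some (q.vertexMap x)}.Finite) :
    {b : T.Branch | T.abuts b = some x}.Finite := by
  haveI : Finite (L.Star (q.vertexMap x)) := h.to_subtype
  haveI : Finite (T.Star x) := Finite.of_injective (Hom.starMap q x) (hq x)
  exact Set.finite_coe_iff.mp (by exact (inferInstance : Finite (T.Star x)))

/-- A semi-graph immersed in a locally finite semi-graph is locally finite.
[cite: MochizukiSemiAnbd2006, §1 pp.13-14] -/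
theorem isLocallyFinite_of_isImmersion {T L : SemiGraph.{u}} (q : T ⟶ L) (hq : IsImmersion q)
    (hL : L.IsLocallyFinite) : T.IsLocallyFinite := by
  refine ⟨fun x => ?_⟩
  -- finitely many branches at `x`, hence finitely many edges at `x`
  have hB : {b : T.Branch | T.abuts b = some x}.Finite := by
    refine finite_star_of_isImmersion_of_finite q hq x ?_
    refine ((hL.finite_edges (q.vertexMap x)).biUnion fun e _ =>
      (show {b : L.Branch | L.edgeOf b = e}.Finite from ?_)).subset ?_
    · obtain ⟨b₁, b₂, -, -, -, hall⟩ := L.two_branches e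
      exact ((Set.finite_singleton b₂).insert b₁).subset fun b hb => by
        rcases hall b hb with rfl | rfl
        · exact Set.mem_insert _ _
        · exact Set.mem_insert_of_mem _ rfl
    · intro b hb
      simp only [Set.mem_iUnion, Set.mem_setOf_eq, exists_prop]
      exact ⟨L.edgeOf b, ⟨b, rfl, hb⟩, rfl⟩
  refine (hB.image T.edgeOf).subset ?_
  rintro e ⟨b, hbe, hbx⟩
  exact ⟨b, hbx, hbe⟩

end SemiGraph

namespace ProfiniteSemiGraph

variable {𝒢 : ProfiniteSemiGraph.{u}}

/-! ### The underlying semi-graph of a finite covering object is locally finite over a locally finite `𝔾` -/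

namespace CovObj

variable (S : CovObj 𝒢)

/-- Over a fixed edge `e` of `𝔾`, a FINITE covering object has finitely many edge-orbits (they are the
orbits of `Π_e` on the finite fibre `S_e`). [cite: MochizukiSemiAnbd2006, Def 3.5(i) p.37] -/
theorem finite_oEdge_over (hS : S.IsFinite) (e : 𝒢.graph.Edge) :
    {E : S.OEdge | CovObj.OEdge.base S E = e}.Finite := by
  haveI := hS.finite_E e
  refine (Set.finite_range fun y : (S.SE e).obj.V => (Quot.mk _ ⟨e, y⟩ : S.OEdge)).subset ?_
  intro E hE
  induction E using Quot.ind with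
  | mk p =>
    obtain ⟨e', y⟩ := p
    change e' = e at hE
    subst hE
    exact ⟨y, rfl⟩

/-- **The underlying semi-graph `𝔾_S` of a finite covering object `S` is locally finite at every
vertex-orbit over a vertex of `𝔾` with finitely many branches**: a branch of `𝔾_S` at `V` is a pair
`(b, E)` with `b` a branch of `𝔾` at the base vertex of `V` and `E` an edge-orbit over the edge of `b`.
[cite: MochizukiSemiAnbd2006, Def 3.5(i) p.37] -/
theorem finite_star_orbitGraph (hS : S.IsFinite) (V : S.OVertex)
    (hv : {b : 𝒢.graph.Branch | 𝒢.graph.abuts b = some (CovObj.OVertex.base S V)}.Finite) :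
    {p : S.orbitGraph.Branch | S.orbitGraph.abuts p = some V}.Finite := by
  -- the finite set of pairs `(b, E)`, `b` at the base of `V`, `E` over the edge of `b`
  have hT : (⋃ b ∈ {b : 𝒢.graph.Branch | 𝒢.graph.abuts b = some (CovObj.OVertex.base S V)},
      ({b} : Set 𝒢.graph.Branch) ×ˢ {E : S.OEdge | CovObj.OEdge.base S E = 𝒢.graph.edgeOf b}).Finite :=
    hv.biUnion fun b _ => (Set.finite_singleton b).prod (S.finite_oEdge_over hS _)
  refine (hT.preimage Subtype.val_injective.injOn).subset ?_
  intro p hp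
  have hb : 𝒢.graph.abuts p.1.1 = some (CovObj.OVertex.base S V) :=
    S.orbitGraphProj.abuts_branchMap p V hp
  simp only [Set.mem_preimage, Set.mem_iUnion, Set.mem_prod, Set.mem_singleton_iff, Set.mem_setOf_eq,
    exists_prop]
  exact ⟨p.1.1, hb, rfl, p.2⟩

/-- **The underlying semi-graph of a finite covering object of a locally finite `𝔾` is locally finite.**
[cite: MochizukiSemiAnbd2006, Def 3.5(i) p.37] -/
theorem orbitGraph_isLocallyFinite (hS : S.IsFinite) (hlf : 𝒢.graph.IsLocallyFinite) :
    S.orbitGraph.IsLocallyFinite := by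
  refine ⟨fun V => ?_⟩
  refine ((S.finite_star_orbitGraph hS V (𝒢.finite_branches_of_isLocallyFinite hlf _)).image
    S.orbitGraph.edgeOf).subset ?_
  rintro E ⟨p, hpE, hpV⟩
  exact ⟨p, hpV, hpE⟩

end CovObj

/-! ### The trees of a Galois tower over a locally finite `𝔾` are locally finite at vertices -/

namespace GaloisLevelData

variable (D : GaloisLevelData 𝒢)

/-- **The tree `𝔾̃_n` of a Galois tower with finite `n`-th level over a locally finite `𝔾` is locally finite
at vertices**: it is immersed (`treeQuot`) in the underlying semi-graph of the finite level, which is locally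
finite over the locally finite `𝔾`. [cite: MochizukiSemiAnbd2006, Thm 3.7(iii) p.41] -/
theorem finite_star_tree (hlf : 𝒢.graph.IsLocallyFinite) (n : ℕ) (hS : (D.S n).IsFinite)
    (x : (D.tree n).Vertex) : {b : (D.tree n).Branch | (D.tree n).abuts b = some x}.Finite :=
  SemiGraph.finite_star_of_isImmersion_of_finite (D.treeQuot n) (D.treeQuot_isImmersion n) x
    ((D.S n).finite_star_orbitGraph hS _ (𝒢.finite_branches_of_isLocallyFinite hlf _))

/-- The tree `𝔾̃_n` of a Galois tower with finite `n`-th level over a locally finite `𝔾` is a locally finite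
semi-graph. [cite: MochizukiSemiAnbd2006, Thm 3.7(iii) p.41] -/
theorem tree_isLocallyFinite (hlf : 𝒢.graph.IsLocallyFinite) (n : ℕ) (hS : (D.S n).IsFinite) :
    (D.tree n).IsLocallyFinite :=
  SemiGraph.isLocallyFinite_of_isImmersion (D.treeQuot n) (D.treeQuot_isImmersion n)
    ((D.S n).orbitGraph_isLocallyFinite hS hlf)

end GaloisLevelData

/-- **At the canonical tower of Prop. 3.6** (`galoisLevelData h36`, whose levels are finite covering
objects, `galoisLevelData_isFinite`): over a locally finite `𝔾` every tree `𝔾̃_n` is locally finite at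
vertices. [cite: MochizukiSemiAnbd2006, Thm 3.7(iii) p.41] -/
theorem finite_star_tree_galoisLevelData (h36 : 𝒢.Prop36Hypotheses) (hlf : 𝒢.graph.IsLocallyFinite)
    (n : ℕ) (x : ((𝒢.galoisLevelData h36).tree n).Vertex) :
    {b : ((𝒢.galoisLevelData h36).tree n).Branch |
      ((𝒢.galoisLevelData h36).tree n).abuts b = some x}.Finite :=
  (𝒢.galoisLevelData h36).finite_star_tree hlf n (𝒢.galoisLevelData_isFinite h36 n) x

/-- The trees of the canonical tower over a locally finite `𝔾` are locally finite semi-graphs.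
[cite: MochizukiSemiAnbd2006, Thm 3.7(iii) p.41] -/
theorem tree_isLocallyFinite_galoisLevelData (h36 : 𝒢.Prop36Hypotheses)
    (hlf : 𝒢.graph.IsLocallyFinite) (n : ℕ) : ((𝒢.galoisLevelData h36).tree n).IsLocallyFinite :=
  (𝒢.galoisLevelData h36).tree_isLocallyFinite hlf n (𝒢.galoisLevelData_isFinite h36 n)

/-- **The binder `hlocfin` DISCHARGED at the level data of record** `verticialLevelData_temperedPiChart`
(whose trees are the `𝔾̃_n` of the canonical tower), for every locally finite `𝔾` — the exact shape
`∀ j x, {b | (D.tree j).abuts b = some x}.Finite` consumed by the level-data theorems of the Thm 3.7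
(iii)/(iv) programme. [cite: MochizukiSemiAnbd2006, Thm 3.7(iii) p.41] -/
theorem hlocfin_verticialLevelData_temperedPiChart (h36 : 𝒢.Prop36Hypotheses)
    (hlf : 𝒢.graph.IsLocallyFinite)
    (j : (verticialLevelData_temperedPiChart (h36 := h36)).J)
    (x : ((verticialLevelData_temperedPiChart (h36 := h36)).tree j).Vertex) :
    {b : ((verticialLevelData_temperedPiChart (h36 := h36)).tree j).Branch |
      ((verticialLevelData_temperedPiChart (h36 := h36)).tree j).abuts b = some x}.Finite :=
  𝒢.finite_star_tree_galoisLevelData h36 hlf j x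

/-- The same in the `Finite (Star _)` currency of `TreeSystemFixedSystemUnique.lean` /
`TemperedVerticialFixUnique.lean`. [cite: MochizukiSemiAnbd2006, Thm 3.7(iii) p.41] -/
theorem finite_star_verticialLevelData_temperedPiChart (h36 : 𝒢.Prop36Hypotheses)
    (hlf : 𝒢.graph.IsLocallyFinite)
    (j : (verticialLevelData_temperedPiChart (h36 := h36)).J)
    (x : ((verticialLevelData_temperedPiChart (h36 := h36)).tree j).Vertex) :
    Finite (((verticialLevelData_temperedPiChart (h36 := h36)).tree j).Star x) :=
  (𝒢.hlocfin_verticialLevelData_temperedPiChart h36 hlf j x).to_subtype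

end ProfiniteSemiGraph

end Literature.AnabelianGeometry.SemiGraphs
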